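import Mathlib.Algebra.Module.Torsion.Basic
import Mathlib.Algebra.Module.Torsion.Free
import Mathlib.Algebra.Module.Submodule.Pointwise
import Mathlib.RingTheory.DiscreteValuationRing.Basic
import Mathlib.LinearAlgebra.Quotient.Basic
import Mathlib.RingTheory.Ideal.Quotient.Basic
import HarnessLib

/-!
# A saturation criterion over a discrete valuation ring (the `Sat-prop2` step of BSTW Prop. 4.12)

Pure commutative algebra, sorry-free; companion to `IwasawaNormalisationTransfer.lean` and
`IwasawaDivisibilityTransfer.lean` (same namespace). Extracted for the cell `bsd-litref/bstw24`
(seat `bsd-litref-bstw24-pv`) as the KERNEL form of reader 1's **Lemma S**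
(`pub/bsd-litref/bstw24/sheets/D-AUDIT-bstw24-r1-ADDENDUM-5.md` §2, sha16 73386cd869069474), which repairs
the inference «it suffices to show that the minimal number of generators of `𝐓̂_P ⊗ Q̄_p⟦X⟧` is one more
than that of `𝐓̂_P⁻ ⊗ Q̄_p⟦X⟧`» in the printed proof of Burungale–Skinner–Tian–Wan, arXiv:2409.01350v2,
Part I, Prop. 4.12 (TeX l.3383–3386; store p0033:L73–79) — the line on which referee C ROUND 381 (ζ)
recorded a valid counterexample to the inference AS WORDED (`B = Rx ⊕ Ry ⊕ (R/X)σ ⊃ A = R(Xx + σ)`: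
`μ(B) = 1 + μ(B/A)` yet the image of `A` in `B/B_tors` is not saturated) and handed the adjudication to
referee C4.

The setting. `R` is a DVR with uniformiser `ϖ`; `T` an `R`-module; `t ∈ T` an element with trivial
annihilator (so `R ∙ t ≅ R` — the line `𝐓̂⁺_P ⊗ R = R·t⁺` of the paper); `T⁻ := T ⧸ R ∙ t`;
`T₁ := T ⧸ T_tors`. The printed `μ`-count gives exactly `t ∉ ϖ • T` (Nakayama). The lemmas:

* `torsionQuotient_mk_not_mem_smul_top` — if `t ∉ ϖ • T` and `ϖ` kills the torsion of `T⁻`, then the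
  image `t̄` of `t` in `T₁` is not in `ϖ • T₁`. (No finite-generation hypothesis is needed.)
* `mem_span_singleton_of_smul_mem_of_not_mem_smul_top` — in a torsion-free module over a DVR, the line
  spanned by an element outside `ϖ • M` is SATURATED (`a ≠ 0`, `a • z ∈ R ∙ m ⇒ z ∈ R ∙ m`).
* `saturated_span_torsionQuotient_mk` — the two combined: Lemma S as printed in the addendum («the
  image of `Rt⁺` in `T₁ := T/T_tors` is saturated»).
* `annihilator_trivial_and_not_mem_smul_top_and_mkQ_mem_smul_top` — the NEGATIVE CONTROL: on the
  referee's module `T = R × R × R/ϖ` with `t = (ϖ, 0, 1)` the first two hypotheses hold and the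
  conclusion of `torsionQuotient_mk_not_mem_smul_top` FAILS, so the torsion hypothesis on `T⁻` cannot
  be dropped (this is referee C R381.2(d)(i)'s counterexample to the printed inference, kernel-checked;
  any domain `R`, any non-unit `ϖ ≠ 0`).

In the counterexample `T⁻ ≅ Ry ⊕ R/ϖ²` has torsion of `ϖ`-length 2, which is precisely what the second
hypothesis forbids; in the paper the hypothesis is supplied by reader 1's Lemma T (the Bellaïche–Dimitrov
ring computation `(𝐓̂⁻_P)_tors ≅ k ⊕ k`), NOT formalised here. What is NOT here: anything about Hida
families, `Λ`-adic forms or `p`-adic `L`-functions; Lemma T; the `μ`-count itself.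
References: BSTW arXiv:2409.01350v2 Part I §4.2, Props. 4.10–4.12 (PREPRINT); Bellaïche–Dimitrov,
arXiv:1907.09422, Thm. 2.
-/

namespace Literature.NumberTheory.EllipticCurves.IwasawaTransfer

open Submodule Pointwise

section SaturationCriterion

variable {R : Type*} [CommRing R] [IsDomain R] [IsDiscreteValuationRing R]
variable {T : Type*} [AddCommGroup T] [Module R T]

/-- **Lemma S, first half (the image of `t` in `T/T_tors` is not divisible by `ϖ`).** `R` a DVR with
uniformiser `ϖ`, `t ∈ T` with trivial annihilator, `t ∉ ϖ • T`, and `ϖ • (T ⧸ R ∙ t)_tors = 0`. Then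
the class of `t` in `T₁ = T ⧸ T_tors` does not lie in `ϖ • T₁`. Proof: if `t = ϖ • y + σ` with `σ`
torsion, then `ϖ^(ℓ+1) • y ∈ R ∙ t` where `ϖ^ℓ σ = 0`, so the class of `y` in `T ⧸ R ∙ t` is torsion,
hence killed by `ϖ`: `ϖ • y = c • t`; then `σ = (1 - c) • t` is torsion in the free line `R ∙ t`, so
`c = 1` and `t = ϖ • y`, contradiction.
[cite: BurungaleSkinnerTianWan2024, Part I Prop. 4.12 (proof, TeX l.3383–3386: the «it suffices» step `Sat-prop2`; ring-theoretic repair step only = reader 1's Lemma S, D-AUDIT-bstw24-r1-ADDENDUM-5 §2; PREPRINT)] -/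
theorem torsionQuotient_mk_not_mem_smul_top {ϖ : R} (hϖ : Irreducible ϖ) {t : T}
    (ht : ∀ a : R, a • t = 0 → a = 0) (h1 : t ∉ ϖ • (⊤ : Submodule R T))
    (h2 : ∀ y ∈ torsion R (T ⧸ (R ∙ t)), ϖ • y = 0) :
    (torsion R T).mkQ t ∉ ϖ • (⊤ : Submodule R (T ⧸ torsion R T)) := by
  intro hmem
  rw [mem_smul_pointwise_iff_exists] at hmem
  obtain ⟨y₁, -, hy₁⟩ := hmem
  obtain ⟨y, rfl⟩ := (torsion R T).mkQ_surjective y₁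
  -- `σ := t - ϖ • y` is a torsion element of `T`
  have hσ : t - ϖ • y ∈ torsion R T := by
    rw [← Quotient.mk_eq_zero, ← mkQ_apply, map_sub, map_smul, hy₁, sub_self]
  obtain ⟨⟨a, ha⟩, haσ⟩ := (mem_torsion_iff _).mp hσ
  have ha0 : a ≠ 0 := nonZeroDivisors.ne_zero ha
  simp only [Submonoid.mk_smul] at haσ
  obtain ⟨ℓ, u, hu⟩ := IsDiscreteValuationRing.associated_pow_irreducible ha0 hϖ
  have hℓ : ϖ ^ ℓ • (t - ϖ • y) = 0 := by
    rw [← hu, mul_comm, mul_smul, haσ, smul_zero]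
  -- in `T⁻ = T ⧸ R ∙ t` the class of `y` is killed by `ϖ ^ (ℓ + 1)`
  have hpow : ϖ ^ (ℓ + 1) • y = ϖ ^ ℓ • t := by
    have : ϖ ^ (ℓ + 1) • y = ϖ ^ ℓ • t - ϖ ^ ℓ • (t - ϖ • y) := by
      rw [pow_succ, mul_smul, smul_sub, sub_sub_cancel]
    rw [this, hℓ, sub_zero]
  have hty : (R ∙ t).mkQ y ∈ torsion R (T ⧸ (R ∙ t)) := by
    refine (mem_torsion_iff _).mpr ⟨⟨ϖ ^ (ℓ + 1), mem_nonZeroDivisors_of_ne_zero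
      (pow_ne_zero _ hϖ.ne_zero)⟩, ?_⟩
    simp only [Submonoid.mk_smul]
    rw [← map_smul, hpow, map_smul, mkQ_apply, (Quotient.mk_eq_zero _).mpr (mem_span_singleton_self t),
      smul_zero]
  -- hence killed by `ϖ`: `ϖ • y = c • t`
  have hϖy : ϖ • y ∈ R ∙ t := by
    rw [← Quotient.mk_eq_zero, ← mkQ_apply, map_smul]
    exact h2 _ hty
  obtain ⟨c, hc⟩ := mem_span_singleton.mp hϖy
  -- then `σ = (1 - c) • t` is torsion in the free line `R ∙ t`, so `c = 1`
  have hc1 : a * (1 - c) = 0 := by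
    apply ht
    rw [mul_smul, sub_smul, one_smul, hc]
    exact haσ
  have hc1' : c = 1 := by
    have := (mul_eq_zero.mp hc1).resolve_left ha0
    exact (sub_eq_zero.mp this).symm
  rw [hc1', one_smul] at hc
  exact h1 ((mem_smul_pointwise_iff_exists _ _ _).mpr ⟨y, mem_top, hc.symm⟩)

variable {M : Type*} [AddCommGroup M] [Module R M]

/-- **A line outside `ϖ • M` in a torsion-free module over a DVR is saturated.** If `M` is a
torsion-free module over a DVR with uniformiser `ϖ` and `m ∉ ϖ • M`, then for every `a ≠ 0`,
`a • z ∈ R ∙ m` implies `z ∈ R ∙ m`. (Write `a ~ ϖ^k`, `a • z = b • m` with `b ~ ϖ^n`; if `n ≥ k`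
cancel `ϖ^k`; if `n < k` cancel `ϖ^n` and read off `m ∈ ϖ • M`.) Elementary; recorded as the second
half of reader 1's Lemma S.
[cite: BurungaleSkinnerTianWan2024, Part I Prop. 4.12 (proof, TeX l.3383–3386, `Sat-prop2`; ring-theoretic repair step only; PREPRINT)] -/
theorem mem_span_singleton_of_smul_mem_of_not_mem_smul_top [Module.IsTorsionFree R M] {ϖ : R}
    (hϖ : Irreducible ϖ) {m : M} (hm : m ∉ ϖ • (⊤ : Submodule R M)) {z : M} {a : R} (ha : a ≠ 0)
    (hz : a • z ∈ R ∙ m) : z ∈ R ∙ m := by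
  obtain ⟨b, hb⟩ := mem_span_singleton.mp hz
  by_cases hb0 : b = 0
  · rw [hb0, zero_smul] at hb
    rw [(smul_eq_zero_iff_right ha).mp hb.symm]
    exact zero_mem _
  obtain ⟨k, u, hu⟩ := IsDiscreteValuationRing.associated_pow_irreducible ha hϖ
  obtain ⟨n, v, hv⟩ := IsDiscreteValuationRing.associated_pow_irreducible hb0 hϖ
  -- `ϖ^n • ((u : R) • m) = ϖ^k • ((v : R) • z)`
  have key : ϖ ^ n • ((u : R) • m) = ϖ ^ k • ((v : R) • z) := by
    have e1 : ϖ ^ n • ((u : R) • m) = ((u : R) * (v : R)) • (b • m) := by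
      rw [← hv, smul_smul, smul_smul]; congr 1; ring
    have e2 : ϖ ^ k • ((v : R) • z) = ((u : R) * (v : R)) • (a • z) := by
      rw [← hu, smul_smul, smul_smul]; congr 1; ring
    rw [e1, e2, hb]
  rcases le_or_gt k n with hkn | hnk
  · -- cancel `ϖ^k`: `v • z = ϖ^(n-k) • u • m`
    obtain ⟨d, rfl⟩ := Nat.exists_eq_add_of_le hkn
    rw [pow_add, mul_smul] at key
    have hvz : (v : R) • z = ϖ ^ d • ((u : R) • m) :=
      (smul_right_injective M (pow_ne_zero k hϖ.ne_zero) key).symm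
    have : z = ((v⁻¹ : Rˣ) : R) • (ϖ ^ d • ((u : R) • m)) := by
      rw [← hvz, ← mul_smul, Units.inv_mul, one_smul]
    rw [this, ← mul_smul, ← mul_smul]
    exact mem_span_singleton.mpr ⟨_, rfl⟩
  · -- cancel `ϖ^n`: `u • m = ϖ^(k-n) • v • z`, so `m ∈ ϖ • M`
    obtain ⟨d, rfl⟩ := Nat.exists_eq_add_of_lt hnk
    rw [show n + d + 1 = n + (d + 1) by ring, pow_add, mul_smul] at key
    have hum : (u : R) • m = ϖ ^ (d + 1) • ((v : R) • z) :=
      smul_right_injective M (pow_ne_zero n hϖ.ne_zero) key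
    refine (hm ((mem_smul_pointwise_iff_exists _ _ _).mpr
      ⟨(((u⁻¹ : Rˣ) : R) * (ϖ ^ d * (v : R))) • z, mem_top, ?_⟩)).elim
    rw [← mul_smul, show ϖ * (((u⁻¹ : Rˣ) : R) * (ϖ ^ d * (v : R))) =
      ((u⁻¹ : Rˣ) : R) * (ϖ ^ (d + 1) * (v : R)) by ring, mul_smul, mul_smul, ← hum, ← mul_smul,
      Units.inv_mul, one_smul]

/-- **Lemma S (reader 1, D-AUDIT-bstw24-r1-ADDENDUM-5 §2), kernel form.** `R` a DVR with uniformiser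
`ϖ`; `0 → R ∙ t → T → T⁻ → 0` with `R ∙ t ≅ R` (trivial annihilator). If `t ∉ ϖ • T` and
`ϖ • (T⁻)_tors = 0`, then the image of `R ∙ t` in `T₁ := T ⧸ T_tors` is SATURATED: for `a ≠ 0` and
`z ∈ T₁`, `a • z ∈ R ∙ t̄ ⇒ z ∈ R ∙ t̄`. This is the module-theoretic input that, together with the
printed `μ`-count (`t ∉ ϖ • T`) and the `k ⊕ k` torsion computation for the Bellaïche–Dimitrov ring
(Lemma T, not formalised), yields `𝐓⁺_P = 𝐓_{v,P}` in BSTW Prop. 4.12 for the height-one primes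
`P = (Φ_{p^r}(1 + T_v))`, `0 < r ≤ h_p`. No finite-generation hypothesis is used.
[cite: BurungaleSkinnerTianWan2024, Part I Prop. 4.12 (proof, TeX l.3383–3386, `Sat-prop2`; ring-theoretic repair step only = Lemma S; PREPRINT)] -/
theorem saturated_span_torsionQuotient_mk {ϖ : R} (hϖ : Irreducible ϖ) {t : T}
    (ht : ∀ a : R, a • t = 0 → a = 0) (h1 : t ∉ ϖ • (⊤ : Submodule R T))
    (h2 : ∀ y ∈ torsion R (T ⧸ (R ∙ t)), ϖ • y = 0) {z : T ⧸ torsion R T} {a : R} (ha : a ≠ 0)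
    (hz : a • z ∈ R ∙ (torsion R T).mkQ t) : z ∈ R ∙ (torsion R T).mkQ t :=
  mem_span_singleton_of_smul_mem_of_not_mem_smul_top hϖ
    (torsionQuotient_mk_not_mem_smul_top hϖ ht h1 h2) ha hz

end SaturationCriterion

section Necessity

variable {R : Type*} [CommRing R] [IsDomain R]

/-- **Negative control: the torsion hypothesis on `T⁻` cannot be dropped** (referee C ROUND 381.2(d)(i)'s
counterexample to the printed «it suffices» inference, kernel-checked). Over any domain `R` and any
irreducible `ϖ`, take `T = R × R × R/(ϖ)` and `t = (ϖ, 0, 1)`. Then (i) `t` has trivial annihilator,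
(ii) `t ∉ ϖ • T` (third coordinate), yet (iii) the class of `t` in `T₁ = T ⧸ T_tors = R × R` is
`(ϖ, 0) = ϖ • (1, 0) ∈ ϖ • T₁` — the line it spans is NOT saturated. Here `T⁻ = T ⧸ R∙t ≅ R ⊕ R/(ϖ²)`
has torsion of `ϖ`-length two, violating hypothesis `h2` of `torsionQuotient_mk_not_mem_smul_top`. In the
`μ`-count language of the paper: `μ(T) = 3 = 1 + μ(T⁻)` although the image of `R∙t` in `T/T_tors` is not
saturated.
[cite: BurungaleSkinnerTianWan2024, Part I Prop. 4.12 (proof, TeX l.3383–3386, `Sat-prop2`: the module `B = Rx ⊕ Ry ⊕ (R/X)σ ⊃ R(Xx + σ)` of referee C R381.2(d)(i) showing the inference as worded is incomplete; ring-theoretic; PREPRINT)] -/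
theorem annihilator_trivial_and_not_mem_smul_top_and_mkQ_mem_smul_top {ϖ : R} (hϖ : Irreducible ϖ) :
    (∀ a : R, a • ((ϖ, 0, Ideal.Quotient.mk (Ideal.span {ϖ}) 1) : R × R × (R ⧸ Ideal.span {ϖ})) = 0
        → a = 0) ∧
      ((ϖ, 0, Ideal.Quotient.mk (Ideal.span {ϖ}) 1) : R × R × (R ⧸ Ideal.span {ϖ})) ∉
        ϖ • (⊤ : Submodule R (R × R × (R ⧸ Ideal.span {ϖ}))) ∧
      (torsion R (R × R × (R ⧸ Ideal.span {ϖ}))).mkQ (ϖ, 0, Ideal.Quotient.mk (Ideal.span {ϖ}) 1) ∈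
        ϖ • (⊤ : Submodule R ((R × R × (R ⧸ Ideal.span {ϖ})) ⧸
          torsion R (R × R × (R ⧸ Ideal.span {ϖ})))) := by
  set I : Ideal R := Ideal.span {ϖ} with hI
  -- `ϖ` kills `R/(ϖ)`
  have hϖI : ∀ x : R ⧸ I, ϖ • x = 0 := by
    rintro ⟨x⟩
    change ϖ • Ideal.Quotient.mk I x = 0
    rw [← Ideal.Quotient.mk_eq_mk, ← Submodule.Quotient.mk_smul, Submodule.Quotient.mk_eq_zero]
    exact Ideal.mem_span_singleton.mpr ⟨x, by rw [smul_eq_mul]⟩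
  refine ⟨?_, ?_, ?_⟩
  · -- (i) first coordinate: `a * ϖ = 0 ⇒ a = 0`
    intro a ha
    have h1 := congrArg Prod.fst ha
    simp only [Prod.smul_fst, smul_eq_mul, Prod.fst_zero, mul_eq_zero] at h1
    exact h1.resolve_right hϖ.ne_zero
  · -- (ii) third coordinate: `ϖ • b = 1` in `R/(ϖ)` forces `1 ∈ (ϖ)`
    intro h
    obtain ⟨b, -, hb⟩ := (mem_smul_pointwise_iff_exists _ _ _).mp h
    have h3 := congrArg (fun x => x.2.2) hb
    simp only [Prod.smul_snd] at h3
    rw [hϖI] at h3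
    have : (1 : R) ∈ I := Ideal.Quotient.eq_zero_iff_mem.mp h3.symm
    exact hϖ.not_isUnit (isUnit_of_dvd_one (Ideal.mem_span_singleton.mp this))
  · -- (iii) `t - ϖ • (1, 0, 0) = (0, 0, 1)` is torsion (killed by `ϖ`)
    refine (mem_smul_pointwise_iff_exists _ _ _).mpr ⟨(torsion R _).mkQ (1, 0, 0), mem_top, ?_⟩
    rw [← map_smul, mkQ_apply, mkQ_apply, eq_comm, Submodule.Quotient.eq]
    refine (mem_torsion_iff _).mpr ⟨⟨ϖ, mem_nonZeroDivisors_of_ne_zero hϖ.ne_zero⟩, ?_⟩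
    simp only [Submonoid.mk_smul, Prod.smul_mk, smul_eq_mul, mul_one, mul_zero, Prod.mk_sub_mk,
      sub_self, sub_zero, smul_zero]
    rw [hϖI]
    rfl

end Necessity

end Literature.NumberTheory.EllipticCurves.IwasawaTransfer
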